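import Summits.CriticalPhenomena.Ising3D.Control2DIsingBlockOperator
import Mathlib.Tactic
import HarnessLib

/-!
# The 2D Ising witness, II: three-term recursions and the `𝓑`-residual of a block expansion
(cell `pub-ising3x`, seat controls-1 gen 37; NON-VACUITY of the 2D control's `A2D′` classes at
`Δ_σ = 1/8` by the Ising datum, step 2 — CONTROL-ONLY)

HONEST FRAMING: lottery ticket; floor = tightest certified 3D Ising CFT bounds; no exact-solution
claim without a proof. CONTROL-ONLY (`d = 2`); nothing numerical is asserted here.

Step 1 (`Control2DIsingBlockOperator`) proved that the BPZ operator `𝓑` of the `c = 1/2` four-point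
function acts on the chiral blocks of a family `h_j = σ + 2j` by a three-term rule with coefficients
`(U_j, Z_j, D_j) = (M₊, M₀, M₋)(h_j)` (with the resonant exceptions at `h = 1/2` and the trivial block
`k_0 = 1`). This file draws the consequence, generically and coefficientwise. For a sequence `c_j`
solving the TRANSPOSED recursion ("rows")

  `c_0 Z_0 + c_1 D_1 = 0`,  `c_j U_j + c_{j+1} Z_{j+1} + c_{j+2} D_{j+2} = 0`     (`IsingFamily`)

the generalised power series `S(x) = Σ_j c_j k_{2h_j}(x) = x^σ Σ_N T_N x^N`,
`T_N = Σ_{2j ≤ N} c_j κ_{h_j}(N - 2j)` (`famCoeff σ c N`), satisfies `𝓑 S = 0` COEFFICIENTWISE: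

  `(σ+N+2)(σ+N+3/2) T_{N+2} - (σ+N+1)(2σ+2N+7/4) T_{N+1} + (σ+N+3/8)(σ+N-1/8) T_N = 0`

(`famCoeff_res`; plus the two lowest coefficients `famCoeff_res_zero/one`) — by collecting
`𝓑 S = (x²/8) Σ_j c_j (U_j k_{2h_{j+1}} + Z_j k_{2h_j} + D_j k_{2h_{j-1}})` along the blocks (a finite
re-indexing of the coefficient of each `x^{σ+N+2}`; no analysis). Since the `x`-Taylor coefficients of
`f₁ = (1-x)^{-1/8}(√(1+√x)+√(1-√x))/2` (resp. `f₂`) satisfy the same second-order recurrence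
(`Control2DIsingTaylor`), which determines a sequence from its first term, `T` IS that Taylor sequence —
this is how `Σ_j c_j k_{2h_j} = f` is proved without closed forms for the `c_j`.
Also here: `threeTermSeq U Z D c₀`, the solution of the rows from `c_0 = c₀` (`D_j ≠ 0`, `j ≥ 1`), with
its defining equations; the two Ising families are instantiated in `Control2DIsingSequences`.
Finite algebra (Finset re-indexing) only.

References: A. A. Belavin, A. M. Polyakov, A. B. Zamolodchikov, Nucl. Phys. B 241 (1984) 333, App. E
[cite: BelavinPolyakovZamolodchikov1984, App. E]; F. A. Dolan, H. Osborn, arXiv:1108.6194, §2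
[cite: DolanOsborn2011, §2 eq. (2.11)]. Tree: `blockRes`, `shiftCoeff`, `chiralCoeff`.
-/

namespace Summit.CriticalPhenomena.Ising3D.Control2D

open Finset
open Literature.MathematicalPhysics.QuantumFieldTheory.ConformalBootstrap3D

/-! ### Sequences solving a transposed three-term recursion -/

/-- The pair recursion behind `threeTermSeq`: `(c_j, c_{j+1})`. [folklore] -/
noncomputable def threeTermAux (U Z D : ℕ → ℝ) (c₀ : ℝ) : ℕ → ℝ × ℝ
  | 0 => (c₀, -(c₀ * Z 0) / D 1)
  | j + 1 => ((threeTermAux U Z D c₀ j).2,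
      -((threeTermAux U Z D c₀ j).2 * Z (j + 1) + (threeTermAux U Z D c₀ j).1 * U j) / D (j + 2))

/-- **The solution of the rows** `c_0 Z_0 + c_1 D_1 = 0`, `c_j U_j + c_{j+1} Z_{j+1} + c_{j+2} D_{j+2} = 0`
starting from `c_0 = c₀`: `c_1 = -c₀ Z_0/D_1`, `c_{j+2} = -(c_{j+1} Z_{j+1} + c_j U_j)/D_{j+2}`.
[folklore] -/
noncomputable def threeTermSeq (U Z D : ℕ → ℝ) (c₀ : ℝ) (j : ℕ) : ℝ := (threeTermAux U Z D c₀ j).1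

section Seq

variable (U Z D : ℕ → ℝ) (c₀ : ℝ)

/-- `c_0 = c₀`. [folklore] -/
@[simp] theorem threeTermSeq_zero : threeTermSeq U Z D c₀ 0 = c₀ := rfl

/-- `c_1 = -c₀ Z_0 / D_1`. [folklore] -/
theorem threeTermSeq_one : threeTermSeq U Z D c₀ 1 = -(c₀ * Z 0) / D 1 := rfl

/-- The recursion step `c_{j+2} = -(c_{j+1} Z_{j+1} + c_j U_j)/D_{j+2}`. [folklore] -/
theorem threeTermSeq_succ_succ (j : ℕ) :
    threeTermSeq U Z D c₀ (j + 2) =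
      -(threeTermSeq U Z D c₀ (j + 1) * Z (j + 1) + threeTermSeq U Z D c₀ j * U j) / D (j + 2) := by
  have h2 : ∀ i, (threeTermAux U Z D c₀ i).2 = threeTermSeq U Z D c₀ (i + 1) := fun i => rfl
  show (threeTermAux U Z D c₀ (j + 1)).2 = _
  simp only [threeTermAux, h2]
  rfl

/-- Row `0`: `c_0 Z_0 + c_1 D_1 = 0` (`D_1 ≠ 0`). [folklore] -/
theorem threeTermSeq_row_zero (hD : D 1 ≠ 0) :
    threeTermSeq U Z D c₀ 0 * Z 0 + threeTermSeq U Z D c₀ 1 * D 1 = 0 := by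
  rw [threeTermSeq_zero, threeTermSeq_one]
  field_simp
  ring

/-- Row `j+1`: `c_j U_j + c_{j+1} Z_{j+1} + c_{j+2} D_{j+2} = 0` (`D_{j+2} ≠ 0`). [folklore] -/
theorem threeTermSeq_row {j : ℕ} (hD : D (j + 2) ≠ 0) :
    threeTermSeq U Z D c₀ j * U j + threeTermSeq U Z D c₀ (j + 1) * Z (j + 1) +
      threeTermSeq U Z D c₀ (j + 2) * D (j + 2) = 0 := by
  rw [threeTermSeq_succ_succ]
  field_simp
  ring

end Seq

/-! ### Families of chiral blocks closed under `𝓑` -/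

/-- **A `𝓑`-closed family with a solution of its rows.** Weights `h_j = σ + 2j`; `(U_j, Z_j, D_j)` the
three-term coefficients of `8 𝓑 k_{2h_j} = x² (U_j k_{2h_{j+1}} + Z_j k_{2h_j} + D_j k_{2h_{j-1}})`
COEFFICIENTWISE (`three_term`, in the bookkeeping of `blockRes`/`shiftCoeff`; `D_0 = 0`: no block below
the first), and `c` a solution of the transposed recursion (`row_zero`, `row`).
[cite: BelavinPolyakovZamolodchikov1984, App. E] -/
structure IsingFamily (σ : ℝ) (U Z D c : ℕ → ℝ) : Prop where
  /-- No block below `h_0`. -/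
  D_zero : D 0 = 0
  /-- The three-term rule for `𝓑 k_{2h_j}`, coefficient of `x^{h_j + M}`. -/
  three_term : ∀ j M : ℕ, 8 * blockRes (σ + 2 * j) M =
    U j * shiftCoeff (σ + 2 * j + 2) 4 M + Z j * shiftCoeff (σ + 2 * j) 2 M +
      D j * chiralCoeff (σ + 2 * j - 2) M
  /-- Row `0` of the transposed recursion. -/
  row_zero : c 0 * Z 0 + c 1 * D 1 = 0
  /-- Rows `j + 1`. -/
  row : ∀ j : ℕ, c j * U j + c (j + 1) * Z (j + 1) + c (j + 2) * D (j + 2) = 0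

/-- **The `x`-coefficients of the block expansion**: `T_N = Σ_{2j ≤ N} c_j κ_{σ+2j}(N - 2j)`, the
coefficient of `x^{σ+N}` in `Σ_j c_j k_{2(σ+2j)}(x)`. [folklore] -/
noncomputable def famCoeff (σ : ℝ) (c : ℕ → ℝ) (N : ℕ) : ℝ :=
  ∑ j ∈ range (N + 1), c j * shiftCoeff (σ + 2 * j) (2 * j) N

section Family

variable {σ : ℝ} {U Z D c : ℕ → ℝ}

/-- `shiftCoeff` is invariant under shifting both indices. [folklore] -/
theorem shiftCoeff_add_add (h : ℝ) (k M a : ℕ) : shiftCoeff h (k + a) (M + a) = shiftCoeff h k M := by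
  unfold shiftCoeff
  by_cases hk : k ≤ M
  · rw [if_pos (by omega), if_pos hk, show M + a - (k + a) = M - k by omega]
  · rw [if_neg (by omega), if_neg hk]

/-- The defining sum of `T_N` may be taken over any longer range (the extra terms vanish).
[folklore] -/
theorem famCoeff_eq_sum (σ : ℝ) (c : ℕ → ℝ) {N K : ℕ} (hK : N + 1 ≤ K) :
    famCoeff σ c N = ∑ j ∈ range K, c j * shiftCoeff (σ + 2 * j) (2 * j) N := by
  obtain ⟨d, rfl⟩ := Nat.exists_eq_add_of_le hK
  induction d with
  | zero => rfl
  | succ d ih =>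
    rw [show N + 1 + (d + 1) = (N + 1 + d) + 1 by ring, sum_range_succ, ← ih (by omega),
      shiftCoeff_of_lt (by omega), mul_zero, add_zero]

/-- `T_0 = c_0`. [folklore] -/
theorem famCoeff_zero (σ : ℝ) (c : ℕ → ℝ) : famCoeff σ c 0 = c 0 := by
  simp [famCoeff, shiftCoeff]

/-- `T_1 = c_0 κ_σ(1)`. [folklore] -/
theorem famCoeff_one (σ : ℝ) (c : ℕ → ℝ) : famCoeff σ c 1 = c 0 * chiralCoeff σ 1 := by
  simp [famCoeff, sum_range_succ, shiftCoeff]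

/-- The per-block bracket: the `𝓑`-residual weights applied to the three shifted coefficients of block
`j` give `blockRes (σ+2j) (N+2-2j)` (or `0` past the range). [folklore] -/
theorem famCoeff_bracket (σ : ℝ) (j N : ℕ) :
    (σ + N + 2) * (σ + N + 3 / 2) * shiftCoeff (σ + 2 * j) (2 * j) (N + 2)
      - (σ + N + 1) * (2 * σ + 2 * N + 7 / 4) * shiftCoeff (σ + 2 * j) (2 * j) (N + 1)
      + (σ + N + 3 / 8) * (σ + N - 1 / 8) * shiftCoeff (σ + 2 * j) (2 * j) N =
      if 2 * j ≤ N + 2 then blockRes (σ + 2 * j) (N + 2 - 2 * j) else 0 := by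
  by_cases h1 : 2 * j ≤ N
  · obtain ⟨m, rfl⟩ := Nat.exists_eq_add_of_le h1
    rw [if_pos (by omega), show 2 * j + m + 2 - 2 * j = m + 2 by omega,
      shiftCoeff_eval (σ + 2 * j) (show 2 * j + m + 2 = (m + 2) + 2 * j by ring),
      shiftCoeff_eval (σ + 2 * j) (show 2 * j + m + 1 = (m + 1) + 2 * j by ring),
      shiftCoeff_eval (σ + 2 * j) (show 2 * j + m = m + 2 * j by ring)]
    simp only [blockRes]
    push_cast
    ring
  · rcases Nat.lt_trichotomy (2 * j) (N + 2) with hlt | heq | hgt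
    · have hj : 2 * j = N + 1 := by omega
      rw [if_pos (by omega), show N + 2 - 2 * j = 1 by omega,
        shiftCoeff_eval (σ + 2 * j) (show N + 2 = 1 + 2 * j by omega),
        shiftCoeff_eval (σ + 2 * j) (show N + 1 = 0 + 2 * j by omega), shiftCoeff_of_lt (by omega)]
      simp only [blockRes]
      have e : (N : ℝ) = 2 * j - 1 := by
        have : ((2 * j : ℕ) : ℝ) = ((N + 1 : ℕ) : ℝ) := by rw [hj]
        push_cast at this
        linarith
      rw [e]
      ring
    · rw [if_pos (by omega), show N + 2 - 2 * j = 0 by omega,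
        shiftCoeff_eval (σ + 2 * j) (show N + 2 = 0 + 2 * j by omega), shiftCoeff_of_lt (by omega),
        shiftCoeff_of_lt (by omega)]
      simp only [blockRes]
      have e : (N : ℝ) = 2 * j - 2 := by
        have : ((2 * j : ℕ) : ℝ) = ((N + 2 : ℕ) : ℝ) := by rw [heq]
        push_cast at this
        linarith
      rw [e]
      ring
    · rw [if_neg (by omega), shiftCoeff_of_lt (by omega), shiftCoeff_of_lt (by omega),
        shiftCoeff_of_lt (by omega)]
      ring

/-- The three-term rule of block `j` in the bookkeeping of `T`: with `κ̃_j(N) = shiftCoeff h_j (2j) N`,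
`8 · bracket_j = U_j κ̃_{j+1}(N) + Z_j κ̃_j(N) + D_j κ̃_{j-1}(N)`. [folklore] -/
theorem famCoeff_bracket_three_term (F : IsingFamily σ U Z D c) (j N : ℕ) :
    8 * (if 2 * j ≤ N + 2 then blockRes (σ + 2 * j) (N + 2 - 2 * j) else 0) =
      U j * shiftCoeff (σ + 2 * (j + 1 : ℕ)) (2 * (j + 1)) N + Z j * shiftCoeff (σ + 2 * j) (2 * j) N +
        D j * (if j = 0 then 0 else shiftCoeff (σ + 2 * (j - 1 : ℕ)) (2 * (j - 1)) N) := by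
  by_cases hj : 2 * j ≤ N + 2
  · rw [if_pos hj, F.three_term j (N + 2 - 2 * j)]
    have e1 : shiftCoeff (σ + 2 * (j + 1 : ℕ)) (2 * (j + 1)) N = shiftCoeff (σ + 2 * j + 2) 4 (N + 2 - 2 * j) := by
      rw [show (σ + 2 * ((j + 1 : ℕ) : ℝ)) = σ + 2 * j + 2 by push_cast; ring,
        ← shiftCoeff_add_add (σ + 2 * j + 2) (2 * (j + 1)) N 2,
        ← shiftCoeff_add_add (σ + 2 * j + 2) 4 (N + 2 - 2 * j) (2 * j),
        show 2 * (j + 1) + 2 = 4 + 2 * j by ring, show N + 2 - 2 * j + 2 * j = N + 2 by omega]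
    have e2 : shiftCoeff (σ + 2 * j) (2 * j) N = shiftCoeff (σ + 2 * j) 2 (N + 2 - 2 * j) := by
      rw [← shiftCoeff_add_add (σ + 2 * j) (2 * j) N 2, ← shiftCoeff_add_add (σ + 2 * j) 2 (N + 2 - 2 * j) (2 * j),
        show 2 + 2 * j = 2 * j + 2 by ring, show N + 2 - 2 * j + 2 * j = N + 2 by omega]
    rw [e1, e2]
    rcases Nat.eq_zero_or_pos j with hj0 | hjpos
    · subst hj0
      simp [F.D_zero]
    · have e3 : (if j = 0 then (0 : ℝ) else shiftCoeff (σ + 2 * (j - 1 : ℕ)) (2 * (j - 1)) N) =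
          chiralCoeff (σ + 2 * j - 2) (N + 2 - 2 * j) := by
        rw [if_neg (by omega), shiftCoeff_eval (σ + 2 * (j - 1 : ℕ)) (show N = (N + 2 - 2 * j) + 2 * (j - 1) by omega),
          Nat.cast_sub (by omega : 1 ≤ j)]
        push_cast
        ring_nf
      rw [e3]
  · rw [if_neg hj, shiftCoeff_of_lt (by omega), shiftCoeff_of_lt (by omega)]
    rcases Nat.eq_zero_or_pos j with hj0 | hjpos
    · omega
    · rw [if_neg (by omega), shiftCoeff_of_lt (by omega)]
      ring

/-- The rows as one function of the block index: `[i ≥ 1] c_{i-1} U_{i-1} + c_i Z_i + c_{i+1} D_{i+1} = 0`.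
[folklore] -/
theorem IsingFamily.row_all (F : IsingFamily σ U Z D c) (i : ℕ) :
    (if i = 0 then 0 else c (i - 1) * U (i - 1)) + c i * Z i + c (i + 1) * D (i + 1) = 0 := by
  rcases i with _ | i
  · simpa using F.row_zero
  · simpa using F.row i

/-- **`𝓑 S = 0` coefficientwise, the generic coefficient** (`x^{σ+N+2}`, `N ≥ 0`): the second-order
recurrence for `T_N = famCoeff σ c N`. [cite: BelavinPolyakovZamolodchikov1984, App. E] -/
theorem famCoeff_res (F : IsingFamily σ U Z D c) (N : ℕ) :
    (σ + N + 2) * (σ + N + 3 / 2) * famCoeff σ c (N + 2)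
      - (σ + N + 1) * (2 * σ + 2 * N + 7 / 4) * famCoeff σ c (N + 1)
      + (σ + N + 3 / 8) * (σ + N - 1 / 8) * famCoeff σ c N = 0 := by
  -- all three coefficient sums over `range (N + 3)`
  rw [famCoeff_eq_sum σ c (show N + 2 + 1 ≤ N + 3 by omega), famCoeff_eq_sum σ c (show N + 1 + 1 ≤ N + 3 by omega),
    famCoeff_eq_sum σ c (show N + 1 ≤ N + 3 by omega)]
  -- combine into one sum of brackets
  have step1 : (σ + N + 2) * (σ + N + 3 / 2) * ∑ j ∈ range (N + 3), c j * shiftCoeff (σ + 2 * j) (2 * j) (N + 2)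
      - (σ + N + 1) * (2 * σ + 2 * N + 7 / 4) * ∑ j ∈ range (N + 3), c j * shiftCoeff (σ + 2 * j) (2 * j) (N + 1)
      + (σ + N + 3 / 8) * (σ + N - 1 / 8) * ∑ j ∈ range (N + 3), c j * shiftCoeff (σ + 2 * j) (2 * j) N =
      ∑ j ∈ range (N + 3), c j * (if 2 * j ≤ N + 2 then blockRes (σ + 2 * j) (N + 2 - 2 * j) else 0) := by
    rw [mul_sum, mul_sum, mul_sum, ← sum_sub_distrib, ← sum_add_distrib]
    refine sum_congr rfl fun j _ => ?_
    rw [← famCoeff_bracket σ j N]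
    ring
  rw [step1]
  -- multiply by 8 and use the three-term rule per block
  have step2 : 8 * ∑ j ∈ range (N + 3), c j * (if 2 * j ≤ N + 2 then blockRes (σ + 2 * j) (N + 2 - 2 * j) else 0) =
      ∑ j ∈ range (N + 3), c j * (U j * shiftCoeff (σ + 2 * (j + 1 : ℕ)) (2 * (j + 1)) N)
        + ∑ j ∈ range (N + 3), c j * (Z j * shiftCoeff (σ + 2 * j) (2 * j) N)
        + ∑ j ∈ range (N + 3), c j * (D j * (if j = 0 then 0 else shiftCoeff (σ + 2 * (j - 1 : ℕ)) (2 * (j - 1)) N)) := by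
    rw [mul_sum, ← sum_add_distrib, ← sum_add_distrib]
    refine sum_congr rfl fun j _ => ?_
    have := famCoeff_bracket_three_term F j N
    linear_combination c j * this
  have h8 : (8 : ℝ) ≠ 0 := by norm_num
  apply (mul_right_inj' h8).mp
  rw [mul_zero, step2]
  -- re-index the `U` sum (`j + 1 = i`) and the `D` sum (`j - 1 = i`) onto `range (N + 4)`
  have hκK : ∀ i, N + 3 ≤ i + 1 → shiftCoeff (σ + 2 * i) (2 * i) N = 0 := fun i hi =>
    shiftCoeff_of_lt (by omega)
  have sumU : ∑ j ∈ range (N + 3), c j * (U j * shiftCoeff (σ + 2 * (j + 1 : ℕ)) (2 * (j + 1)) N) =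
      ∑ i ∈ range (N + 4), (if i = 0 then 0 else c (i - 1) * U (i - 1)) * shiftCoeff (σ + 2 * i) (2 * i) N := by
    conv_rhs => rw [sum_range_succ']
    rw [if_pos rfl, zero_mul, add_zero]
    refine sum_congr rfl fun j _ => ?_
    rw [if_neg (by omega), Nat.add_sub_cancel]
    ring
  have sumZ : ∑ j ∈ range (N + 3), c j * (Z j * shiftCoeff (σ + 2 * j) (2 * j) N) =
      ∑ i ∈ range (N + 4), c i * Z i * shiftCoeff (σ + 2 * i) (2 * i) N := by
    conv_rhs => rw [sum_range_succ]
    rw [hκK (N + 3) (by omega), mul_zero, add_zero]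
    refine sum_congr rfl fun j _ => ?_
    ring
  have sumD : ∑ j ∈ range (N + 3), c j * (D j * (if j = 0 then 0 else shiftCoeff (σ + 2 * (j - 1 : ℕ)) (2 * (j - 1)) N)) =
      ∑ i ∈ range (N + 4), c (i + 1) * D (i + 1) * shiftCoeff (σ + 2 * i) (2 * i) N := by
    conv_lhs => rw [sum_range_succ']
    conv_rhs => rw [sum_range_succ, sum_range_succ]
    rw [if_pos rfl, mul_zero, mul_zero, add_zero, hκK (N + 3) (by omega), hκK (N + 2) (by omega),
      mul_zero, mul_zero, add_zero, add_zero]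
    refine sum_congr rfl fun i _ => ?_
    rw [if_neg (by omega), Nat.add_sub_cancel]
    ring
  rw [sumU, sumZ, sumD, ← sum_add_distrib, ← sum_add_distrib]
  refine sum_eq_zero fun i _ => ?_
  have := F.row_all i
  linear_combination shiftCoeff (σ + 2 * i) (2 * i) N * this

/-- **The lowest coefficient** (`x^σ`): `σ(σ - 1/2) T_0 = 0` (indicial). [folklore] -/
theorem famCoeff_res_zero (F : IsingFamily σ U Z D c) : σ * (σ - 1 / 2) * famCoeff σ c 0 = 0 := by
  have h := F.three_term 0 0
  simp only [Nat.cast_zero, mul_zero, add_zero, F.D_zero, zero_mul,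
    shiftCoeff_of_lt (by norm_num : 0 < 4), shiftCoeff_of_lt (by norm_num : 0 < 2), blockRes,
    chiralCoeff_zero_right] at h
  rw [famCoeff_zero]
  have h0 : σ * (σ - 1 / 2) = 0 := by linarith
  rw [h0, zero_mul]

/-- **The next coefficient** (`x^{σ+1}`): `(σ+1)(σ+1/2) T_1 - σ(2σ-1/4) T_0 = 0`. [folklore] -/
theorem famCoeff_res_one (F : IsingFamily σ U Z D c) :
    (σ + 1) * (σ + 1 / 2) * famCoeff σ c 1 - σ * (2 * σ - 1 / 4) * famCoeff σ c 0 = 0 := by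
  have h := F.three_term 0 1
  simp only [Nat.cast_zero, mul_zero, add_zero, F.D_zero, zero_mul,
    shiftCoeff_of_lt (by norm_num : 1 < 4), shiftCoeff_of_lt (by norm_num : 1 < 2), blockRes,
    chiralCoeff_zero_right] at h
  rw [famCoeff_zero, famCoeff_one]
  linear_combination (c 0 / 8) * h

end Family

end Summit.CriticalPhenomena.Ising3D.Control2D
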